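import Summits.Ventures.Crystal3D.Theorems.StickyWulffConstantCoaxialWallLawFrame
import Summits.Ventures.Crystal3D.Theorems.StickyWulffConstantGenericWallFloorAffineSampleDeficit
import HarnessLib

/-!
# The clamped slab of the other grain blocks foreign sites (riser ledger, blocked window)

HONEST FRAMING. Part of the venture `Summits/Ventures/Crystal3D` (cell `crystal3d-full`), helper
`--supports` the crux `CoaxialWallLaw` (stmt-Ventures-19481, `route-Ventures-StickyWulffConstant`),
REGISTERED line `WallLedgerF` (planner cf-p1 gen 16), stub `stub_coaxialTwoSlabAdhesion`;
usable by `WallLedgerG` (stmt-Ventures-19480).  Supplies the «blocked window» hypothesis of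
`forced_runEnds_offset` (`…CoaxialWallLawForcedEnds`) in the crux's cell vocabulary
(independent of that file; only `norm_sub_inner_smul_sq` and the covering radius are used).

**Theorem (`blockedWindow_not_mem`).**  Let `X` be a unit packing (pairwise distances `≥ 1`)
containing the COMPLETE clamped sample of the grain `Λ = A·Λ₀ + t` in the window
`{lo ≤ p₂ ≤ hi, p₀² + p₁² ≤ ρ²}`.  Then no point `z ∉ Λ` with `lo + 1 ≤ z₂ ≤ hi − 1` and
`z₀² + z₁² ≤ (ρ − 1)²` (`ρ ≥ 1`) belongs to `X`: by the covering radius of the moved lattice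
(`movedFcc_exists_dist_sq_le_half`) some site `y ∈ Λ` has `dist z y ≤ 1/√2 < 1`; its height and
lateral radius differ from those of `z` by at most `dist z y` (coordinate and lateral-projection
bounds), so `y` lies in the clamped window, hence `y ∈ X`, and `z ∈ X` would violate the packing
constraint (`z ≠ y` as `z ∉ Λ`).  In the rigid wall cell this says: sites of grain 1 inside grain 2's
clamped slab (shrunk by `1`) are VACANT — the in-plane bond lines of grain 1 are blocked there.

WHAT THIS IS NOT: the run-end count itself (`…ForcedEnds`); the stub; rung F-C1 not moved.
-/

noncomputable section

namespace Summit.Ventures.Crystal3D.Theorems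

open Summit.Ventures.Crystal3D Finset
open Literature.MathematicalPhysics.StatisticalMechanics (fccStacking)
open scoped InnerProductSpace

/-- A coordinate difference is bounded by the distance. -/
theorem abs_apply_sub_le_dist (p q : EuclideanSpace ℝ (Fin 3)) (i : Fin 3) :
    |p i - q i| ≤ dist p q := by
  have h : dist (p i) (q i) ^ 2 ≤ ∑ j, dist (p j) (q j) ^ 2 :=
    Finset.single_le_sum (fun j _ => sq_nonneg (dist (p j) (q j))) (Finset.mem_univ i)
  calc |p i - q i| = dist (p i) (q i) := (Real.dist_eq _ _).symm
    _ = Real.sqrt (dist (p i) (q i) ^ 2) := (Real.sqrt_sq dist_nonneg).symm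
    _ ≤ Real.sqrt (∑ j, dist (p j) (q j) ^ 2) := Real.sqrt_le_sqrt h
    _ = dist p q := (EuclideanSpace.dist_eq p q).symm

/-- The lateral radius `√(p₀² + p₁²)` is `1`-Lipschitz: `√(y₀²+y₁²) ≤ √(z₀²+z₁²) + dist y z`. -/
theorem lateral_radius_le_add_dist (y z : EuclideanSpace ℝ (Fin 3)) :
    Real.sqrt (y 0 ^ 2 + y 1 ^ 2) ≤ Real.sqrt (z 0 ^ 2 + z 1 ^ 2) + dist y z := by
  set e₃ : EuclideanSpace ℝ (Fin 3) := EuclideanSpace.single (2 : Fin 3) (1 : ℝ) with he₃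
  have hν : ‖e₃‖ = 1 := by rw [he₃, PiLp.norm_single, norm_one]
  have hlat : ∀ p : EuclideanSpace ℝ (Fin 3),
      Real.sqrt (p 0 ^ 2 + p 1 ^ 2) = ‖p - ⟪p, e₃⟫_ℝ • e₃‖ := by
    intro p
    rw [sq_add_sq_eq_norm_sq_sub, ← he₃, ← norm_sub_inner_smul_sq e₃ p hν, Real.sqrt_sq (norm_nonneg _)]
  rw [hlat, hlat]
  have hsplit : y - ⟪y, e₃⟫_ℝ • e₃ = (z - ⟪z, e₃⟫_ℝ • e₃) + ((y - z) - ⟪y - z, e₃⟫_ℝ • e₃) := by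
    rw [inner_sub_left, sub_smul]; abel
  rw [hsplit]
  calc ‖z - ⟪z, e₃⟫_ℝ • e₃ + (y - z - ⟪y - z, e₃⟫_ℝ • e₃)‖
      ≤ ‖z - ⟪z, e₃⟫_ℝ • e₃‖ + ‖y - z - ⟪y - z, e₃⟫_ℝ • e₃‖ := norm_add_le _ _
    _ ≤ ‖z - ⟪z, e₃⟫_ℝ • e₃‖ + ‖y - z‖ := by
        have hq : ‖y - z - ⟪y - z, e₃⟫_ℝ • e₃‖ ≤ ‖y - z‖ := by
          have h := norm_sub_inner_smul_sq e₃ (y - z) hν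
          have h1 : ‖y - z - ⟪y - z, e₃⟫_ℝ • e₃‖ ^ 2 ≤ ‖y - z‖ ^ 2 := by
            rw [h]; nlinarith [sq_nonneg ⟪y - z, e₃⟫_ℝ]
          exact (pow_le_pow_iff_left₀ (norm_nonneg _) (norm_nonneg _) two_ne_zero).1 h1
        linarith
    _ = ‖z - ⟪z, e₃⟫_ℝ • e₃‖ + dist y z := by rw [dist_eq_norm]

/-- **The clamped slab of a grain blocks foreign sites.**  `X` a unit packing containing every
site of `Λ = A·Λ₀ + t` in the window `{lo ≤ p₂ ≤ hi, p₀² + p₁² ≤ ρ²}` (`ρ ≥ 1`); then a point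
`z ∉ Λ` with `lo + 1 ≤ z₂ ≤ hi − 1` and `z₀² + z₁² ≤ (ρ − 1)²` is not in `X`. -/
theorem blockedWindow_not_mem
    (A : EuclideanSpace ℝ (Fin 3) ≃ₗᵢ[ℝ] EuclideanSpace ℝ (Fin 3)) (t : EuclideanSpace ℝ (Fin 3))
    (X : Finset (EuclideanSpace ℝ (Fin 3)))
    (hX : ∀ p ∈ X, ∀ q ∈ X, p ≠ q → 1 ≤ dist p q)
    (lo hi ρ : ℝ) (hρ : 1 ≤ ρ)
    (hcomplete : ∀ p ∈ (fun q => A q + t) '' fccStacking 1 (Real.sqrt (2 / 3)),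
      lo ≤ p 2 → p 2 ≤ hi → p 0 ^ 2 + p 1 ^ 2 ≤ ρ ^ 2 → p ∈ X)
    (z : EuclideanSpace ℝ (Fin 3)) (hzΛ : z ∉ (fun q => A q + t) '' fccStacking 1 (Real.sqrt (2 / 3)))
    (hzlo : lo + 1 ≤ z 2) (hzhi : z 2 ≤ hi - 1) (hzlat : z 0 ^ 2 + z 1 ^ 2 ≤ (ρ - 1) ^ 2) :
    z ∉ X := by
  intro hzX
  obtain ⟨y, hyΛ, hyd⟩ := movedFcc_exists_dist_sq_le_half A t z
  have hzy : z ≠ y := fun h => hzΛ (h ▸ hyΛ)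
  have hd1 : dist z y < 1 := by
    have h0 : 0 ≤ dist z y := dist_nonneg
    nlinarith
  -- `y` lies in the clamped window
  have hd : dist y z < 1 := by rwa [dist_comm]
  have hy2 : |y 2 - z 2| ≤ dist y z := abs_apply_sub_le_dist y z 2
  have hy2' := abs_le.1 hy2
  have hylo : lo ≤ y 2 := by linarith [hy2'.1]
  have hyhi : y 2 ≤ hi := by linarith [hy2'.2]
  have hylat : y 0 ^ 2 + y 1 ^ 2 ≤ ρ ^ 2 := by
    have h1 := lateral_radius_le_add_dist y z
    have h2 : Real.sqrt (z 0 ^ 2 + z 1 ^ 2) ≤ ρ - 1 := by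
      rw [← Real.sqrt_sq (by linarith : (0 : ℝ) ≤ ρ - 1)]
      exact Real.sqrt_le_sqrt hzlat
    have h3 : Real.sqrt (y 0 ^ 2 + y 1 ^ 2) ≤ ρ := by linarith
    have h4 : 0 ≤ y 0 ^ 2 + y 1 ^ 2 := by positivity
    calc y 0 ^ 2 + y 1 ^ 2 = Real.sqrt (y 0 ^ 2 + y 1 ^ 2) ^ 2 := (Real.sq_sqrt h4).symm
      _ ≤ ρ ^ 2 := pow_le_pow_left₀ (Real.sqrt_nonneg _) h3 2
  have hyX : y ∈ X := hcomplete y hyΛ hylo hyhi hylat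
  have h1 := hX z hzX y hyX hzy
  linarith

end Summit.Ventures.Crystal3D.Theorems

end
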